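import Summits.QuantumAdvantage.QuantumAdvantage.Theses.CubicForrelation
import Literature.Computability.QuantumComplexity.SignedCubicForrelation
import Literature.Computability.QuantumComplexity.ForrelationMSubspaceDuality
import Literature.Computability.Complexity.F2RowReduction
import Literature.Computability.Complexity.StackLists
import Literature.Computability.Complexity.CountingHierarchyInter
import Summits.QuantumAdvantage.QuantumAdvantage.Theorems.SignedCubicForrelationInPrBPP.Negative.GoldCube
import Summits.QuantumAdvantage.QuantumAdvantage.Theorems.SignedCubicForrelationInPrBPP.Negative.CrossCorrelation
import Summits.QuantumAdvantage.QuantumAdvantage.Theorems.CubicForrelationSignedCubicForrelationInPrBPPStubHeredity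
import Summits.QuantumAdvantage.QuantumAdvantage.Theorems.CubicForrelationSignedCubicForrelationInPrBPPStubDualValue
import Summits.QuantumAdvantage.QuantumAdvantage.Theorems.CubicForrelationSignedCubicForrelationInPrBPPStubCertify

/-!
# Line `polar-radical-seeds` — LEAD skeleton r2 (RELAXED MM side) for crux `SignedCubicForrelationInPrBPP` (stmt-QuantumAdvantage-13933)

Lead prover `prover-line-stmt-QuantumAdvantage-13933-0` (2026-08-16). History: r0 = crux-plan skeleton (6 stubs);
r1 (registered 05:48Z) = self-contained signatures + `stub_certify`, 7 stubs, of which `stub_heredity` (p84279),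
`stub_dualValue` (p85203), `stub_certify` (p85991), `stub_passThrough` (p86886) are LANDED and the exact machine
`stub_safeMM` is a worker's job; r2 (this file) RESHAPES the two open stubs of r1 (`stub_finder`, `stub_residue`)
after the lead's kit probes (`Finder-analysis.md` on the item):

* RELAXATION. The dual-value readout works for EVERY certified `⊕`-closed `V ∋ 0` on whose cosets one function is
  affine, with mean exactly `Φ·|V|·2^{-n/2}`: a `V` of dimension `n/2 − t` costs a factor `4^t` in samples, so any
  M-DEFECT `t ≤ c·log₂ n` is polynomial, and "junk" seeds (certified directions outside the hidden M-subspace — the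
  failure mode of the exact finder on `x³ ⊕ x³`, shears, rank-one maps) become harmless. Empirically the pool
  {level-`D` polar-radical seeds} ∪ `Rad T`, assembled greedily under the pairwise certificate, reaches `t ≤ 2` on
  every family probed (`m ≤ 12`).
* CONSEQUENCE FOR THE SHAPE. With the relaxed MM side the residue is EMPTY as soon as every in-promise pair has
  logarithmic M-defect on one side — a purely structural, finite-witness-refutable statement (`stub_structure`, the
  new crux-sized stub, true on everything on file: MM# exact pairs defect 0, P₄ defect 2, the 7/8 · 13/16 · 15/16
  families MM-shaped on one side, glued in-promise families bounded because `Φ` multiplies). So r2 =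
  `stub_residueR` (crux-sized, never falser than the crux; discharged by `stub_structure`, registered alongside as the
  intended, attackable route) + `stub_finderR` (item-sized, ∈ FP) + `stub_safeMMR` (machine, closed) + the landed
  `stub_dualValue`, `stub_certify`, `stub_passThrough`; `stub_heredity` stays as the
  finder's landed lever (not consumed by the composition any more).

Crux (route `QuantumAdvantage/CubicForrelation`, rank 7, `¬X`):
`Summit.QuantumAdvantage.QuantumAdvantage.Theses.CubicForrelation.SignedCubicForrelationInPrBPP`
`= (signedCubicForrelationProblem 2 ∈ PromiseBPP')` (`rfl`): SIGNED cubic 2-fold Forrelation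
(YES `Φ ≥ 3/5`, NO `Φ ≤ -3/5`; `n` even, both circuits of 𝔽₂-degree `≤ 3`) is in textbook promise-BPP.

Stubs of r2:
* `stub_structure` (OPEN, crux-sized): `∃ c`, every cubic pair with `|Φ| ≥ 3/5` on evenly many bits has a `⊕`-closed
  `V ∋ 0`, `2ⁿ ≤ |V|²(n+2)^{2c}`, with `f` OR `g` affine on its cosets.
* `stub_finderR` (OPEN, item-sized, the lead's): `∀ c ∃ c'`, an `FP` finder that, on promise instances whose second
  function has M-defect `≤ c log₂(n+2)`, outputs with probability `≥ 2/3` rows of defect `≤ c' log₂(n+2)` spanning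
  a certified coset-affine subspace.
* `stub_safeMMR` (closed given its hypotheses, L–XL plumbing = the r1 machine with the round count read off the
  certificate): the safe partial decider, complete on the relaxed MM side.
* landed: `stub_heredity`, `stub_dualValue`, `stub_certify`, `stub_passThrough`.
* `stub_residueR` (OPEN, crux-sized, never falser than the crux): `∃ c`, the signed problem on promise instances with
  both-sided M-defect `> c log₂(n+2)` is in `PromiseBPP'` — EMPTY under `stub_structure` (`residueR_of_structure`).
Composition `SignedCubicForrelationInPrBPP_of`: residueR's `c` ⇒ finderR ⇒ safeMMR ⇒ passThrough with the residue.

Disproof.lean (cdisprove 13933, v4 §4) used: all r1 verdicts (heredity/dualValue/certify/passThrough TRUE — now landed;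
finder's killers = degenerate `π` — absorbed by the relaxation; residue NONEMPTY via P₄, `Negative/ResidueNonempty` —
P₄ has M-defect 2, inside the relaxed MM side, which is WHY r2 trades the residue for `stub_structure`); §2 (no
`_false_without_`); §3a honoured (statistic flips under `g ↦ ¬g`); §3b/§3c consistent. Landed Literature used by the
analysis: `ForrelationCosetAffineBound.lean` (p89036: a coset-affine `V` has `|Φ|·|V| ≤ √(2ⁿ)`, so on the promise the
M-defect is `≥ 0`). Negatives index: `CubicStability` (stmt-2202) REFUTED — used nowhere.
-/

noncomputable section

set_option linter.dupNamespace false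

namespace Summit.QuantumAdvantage.QuantumAdvantage.Cruxes.SignedCubicForrelationInPrBPP.PolarRadicalSeeds

open Finset
open Literature.Computability.Complexity Literature.Computability.QuantumComplexity
open Literature.Computability.QuantumComplexity.BuzetChailloux (bxor zeroVec)
open Summit.QuantumAdvantage.QuantumAdvantage.Theses.CubicForrelation

/-! ## Registered stubs (self-contained signatures) -/

/-- STUB `stub_heredity` (M, provable now — THE LEVER). Seed heredity over `𝔽₂`: `T` symmetric trilinear
on `𝔽₂ⁿ`, `E` a submodule with `T(E,E,·) = 0` and `n ≤ 2 dim E`; then for every `ξ` the radical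
`R_ξ = ker (T ξ)` satisfies `dim R_ξ ≤ 2 dim (E ⊓ R_ξ)`. Proof: `e ↦ T ξ e` maps `E` into the dual
annihilator of `E ⊔ R_ξ` with kernel `E ⊓ R_ξ`; rank–nullity and `dim (E ⊔ R) + dim (E ⊓ R) = dim E + dim R`. -/
theorem stub_heredity : ∀ (n : ℕ)
    (T : (Fin n → ZMod 2) →ₗ[ZMod 2] (Fin n → ZMod 2) →ₗ[ZMod 2] (Fin n → ZMod 2) →ₗ[ZMod 2] ZMod 2)
    (E : Submodule (ZMod 2) (Fin n → ZMod 2)),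
    (∀ u v w, T u v w = T v u w) → (∀ u v w, T u v w = T u w v) →
    (∀ e ∈ E, ∀ e' ∈ E, ∀ w, T e e' w = 0) →
    n ≤ 2 * Module.finrank (ZMod 2) E →
    ∀ ξ : Fin n → ZMod 2,
      Module.finrank (ZMod 2) (LinearMap.ker (T ξ)) ≤
        2 * Module.finrank (ZMod 2) ↥(E ⊓ LinearMap.ker (T ξ)) :=
  Theorems.SignedCubicForrelationInPrBPP.stub_heredity

/-- STUB `stub_structure` (OPEN, crux-sized — the STRUCTURE CONJECTURE in M-defect form; the intended discharge of
`stub_residueR` (`residueR_of_structure` below); registered so that it can be attacked, NOT consumed by the composition).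
There is an absolute `c` such that for every cubic pair `(f, g)` on evenly many bits with `|Φ(f,g)| ≥ 3/5`, ONE of the two
functions is affine on every coset of some `⊕`-closed `V ∋ 0` with `|V|² · (n+2)^{2c} ≥ 2ⁿ` (M-defect `≤ c·log₂(n+2)`).
True with `c = 0` on the whole completed Maiorana–McFarland side and on every exact pair known (MM#); true on every sporadic /
band instance on file (P₄: defect 2; the 13/16, 7/8, 15/16 families: MM-shaped on one side); an asymptotic counterexample needs
in-promise pairs whose BOTH halves have unbounded M-defect (none known: Disproof §3d–e, §4); the visible route to one is
ALTERNATING GLUE of a family of near-exact pairs `Φ_j → 1` with one-sided non-MM defect (so this stub is morally at least as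
strong as a family form of route item r2 `NearExactIsExact`; see `Finder-analysis.md` §5 on the item). NOT implied by the crux.
With this structure statement the residue `stub_residueR` of the relaxed MM side is EMPTY. -/
theorem stub_structure : ∃ c : ℕ, ∀ (n : ℕ), Even n → ∀ f g : (Fin n → Bool) → Bool,
    IsDegLeFun 3 f → IsDegLeFun 3 g → (3 / 5 : ℝ) ≤ |forrelation f g| →
    ∃ V : Finset (Fin n → Bool), zeroVec ∈ V ∧ (∀ x ∈ V, ∀ y ∈ V, bxor x y ∈ V) ∧
      2 ^ n ≤ V.card ^ 2 * (n + 2) ^ (2 * c) ∧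
      ((∀ u ∈ V, ∀ v ∈ V, ∀ y, (f y ^^ f (bxor y u) ^^ f (bxor y v) ^^ f (bxor y (bxor u v))) = false) ∨
       (∀ u ∈ V, ∀ v ∈ V, ∀ y, (g y ^^ g (bxor y u) ^^ g (bxor y v) ^^ g (bxor y (bxor u v))) = false)) := by
  sorry

/-- STUB `stub_finderR` (OPEN, item-sized — RELAXED M-subspace recovery ∈ FBPP; the line's algorithmic content). For every defect
constant `c` there are an output constant `c'`, a polynomial-time `find` and a coin polynomial `p` such that on every two-circuit
promise instance (`n` even, `B₂`, degree `≤ 3`, `|Φ| ≥ 3/5`) whose SECOND function `g` is affine on the cosets of a `⊕`-closed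
`V ∋ 0` with `|V|²(n+2)^{2c} ≥ 2ⁿ`, at least `2/3` of the coin strings make `find` output rows `L` with
`n ≤ 2·rank(L) + c'·log₂(n+2)` and `g` affine on every coset of their span. Intended witness (kit probes of the lead, 2026-08-16):
pool = level-`D` polar-radical seeds (`ξ` random, `dim R_ξ ≤ 2D`, polar rank `≥ n/2`) ∪ `Rad T_g`, assembled by greedy
pairwise-certified growth, best of `K` random orders — empirically `t ≤ 1` on Gold, Gold sums, `x³+Tr(x⁹)`, random quadratic maps,
shears, iterated shears, rank-one maps (`m ≤ 12`); no worst-case proof (greedy clique growth). -/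
theorem stub_finderR : ∀ c : ℕ, ∃ c' : ℕ, ∃ find ∈ FP, ∃ p : Polynomial ℕ, ∀ (I : KForrelationInstance) (hk : I.k = 2),
      Even I.n → I.IsOverB2 → (∀ i, IsDegLeFun 3 (I.C i).eval) → (3 / 5 : ℝ) ≤ |I.value| →
      (∃ V : Finset (Fin I.n → Bool), zeroVec ∈ V ∧ (∀ x ∈ V, ∀ y ∈ V, bxor x y ∈ V) ∧
        2 ^ I.n ≤ V.card ^ 2 * (I.n + 2) ^ (2 * c) ∧
        ∀ u ∈ V, ∀ v ∈ V, ∀ y, ((I.C (Fin.cast hk.symm 1)).eval y ^^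
          (I.C (Fin.cast hk.symm 1)).eval (bxor y u) ^^ (I.C (Fin.cast hk.symm 1)).eval (bxor y v) ^^
          (I.C (Fin.cast hk.symm 1)).eval (bxor y (bxor u v))) = false) →
      (2 / 3 : ℝ) ≤ uniformProb (p.eval I.encode.length)
        {y | ∃ L : List (List Bool), find (boolPair I.encode y) = encList L ∧
          I.n ≤ 2 * Module.finrank (ZMod 2) ↥(F2Elim.rowSpan I.n L) + c' * Nat.log 2 (I.n + 2) ∧
          ∀ u v : Fin I.n → Bool, (fun i => if u i then (1 : ZMod 2) else 0) ∈ F2Elim.rowSpan I.n L →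
            (fun i => if v i then (1 : ZMod 2) else 0) ∈ F2Elim.rowSpan I.n L →
          ∀ y, ((I.C (Fin.cast hk.symm 1)).eval y ^^
            (I.C (Fin.cast hk.symm 1)).eval (bxor y u) ^^ (I.C (Fin.cast hk.symm 1)).eval (bxor y v) ^^
            (I.C (Fin.cast hk.symm 1)).eval (bxor y (bxor u v))) = false} := by
  sorry

/-- STUB `stub_dualValue` (M, provable now — the ONE sign-readout lemma of the line). If `g` is affine on the
cosets of a `⊕`-closed `V ∋ 0` then (a) for EVERY `f`,
`Σ_z Σ_{x ≡ z} (-1)^{f x} (-1)^{g z} (-1)^{x·z} = √(2^{3n}) · Φ(f,g)`, where `x ≡ z` means that the character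
`v ↦ (-1)^{x·v}` of `V` is the linear part `v ↦ (-1)^{g(z ⊕ v) + g z}` of `g` on `z ⊕ V` (for each `x` the
`z`-sum over matching cosets IS `W_g(x)`; cf. `SeedToSign.W_eq_sum_matched` in `Lines/seed_to_sign.lean`), and
(b) for every `z` the matching `x` form a coset of `V^⊥`: `#{x ≡ z} · |V| = 2ⁿ` (`exists_twist_eq_char` +
`card_mul_card_perp`). No bentness, no half-dimension needed. -/
theorem stub_dualValue : ∀ (n : ℕ) (f g : (Fin n → Bool) → Bool) (V : Finset (Fin n → Bool)),
    zeroVec ∈ V → (∀ x ∈ V, ∀ y ∈ V, bxor x y ∈ V) →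
    (∀ u ∈ V, ∀ v ∈ V, ∀ y, (g y ^^ g (bxor y u) ^^ g (bxor y v) ^^ g (bxor y (bxor u v))) = false) →
    (∑ z : Fin n → Bool,
        ∑ x ∈ univ.filter (fun x => ∀ v ∈ V, twist x v = signOf (g (bxor z v)) * signOf (g z)),
          signOf (f x) * signOf (g z) * twist x z =
      Real.sqrt (2 ^ (3 * n)) * forrelation f g) ∧
    (∀ z : Fin n → Bool,
      ((univ.filter (fun x => ∀ v ∈ V, twist x v = signOf (g (bxor z v)) * signOf (g z))).card : ℝ) *
        V.card = (2 : ℝ) ^ n) :=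
  Theorems.SignedCubicForrelationInPrBPP.stub_dualValue

/-- STUB `stub_certify` (M, provable now — the certificate is a finite check). For `g` of 𝔽₂-degree `≤ 3` and
rows `L`: if the second difference `D_r D_s g` vanishes at `0` and at every unit vector for all pairs of rows,
then `g` is affine on every coset of the `𝔽₂`-span of the rows (read back as bit vectors). Proof:
`D_r D_s g` has degree `≤ 1` (two derivatives of a cubic), an affine function vanishing at `0` and the unit
vectors vanishes identically; then induct over the span with `D_{u ⊕ u'} D_v g (y) = D_u D_v g (y) ⊕ D_{u'} D_v g (y ⊕ u)`. -/
theorem stub_certify : ∀ (n : ℕ) (g : (Fin n → Bool) → Bool), IsDegLeFun 3 g →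
    ∀ L : List (List Bool),
    (∀ r ∈ L, ∀ s ∈ L, ∀ y : Fin n → Bool, (y = zeroVec ∨ ∃ i : Fin n, y = fun j => decide (j = i)) →
      (g y ^^ g (bxor y (fun i => r.getD i false)) ^^ g (bxor y (fun i => s.getD i false)) ^^
        g (bxor y (bxor (fun i => r.getD i false) (fun i => s.getD i false)))) = false) →
    ∀ u v : Fin n → Bool, (fun i => if u i then (1 : ZMod 2) else 0) ∈ F2Elim.rowSpan n L →
      (fun i => if v i then (1 : ZMod 2) else 0) ∈ F2Elim.rowSpan n L →
    ∀ y, (g y ^^ g (bxor y u) ^^ g (bxor y v) ^^ g (bxor y (bxor u v))) = false :=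
  Theorems.SignedCubicForrelationInPrBPP.stub_certify

/-- STUB `stub_safeMM` — the EXACT special case of `stub_safeMMR` (`c = c' = 0`: half-dimensional M-subspaces, 200 rounds), kept REGISTERED in r2 because a worker's machine for it is in flight (its proposal must match a registered stub); not consumed by the r2 composition. (XL formalisation; mathematics closed given its three hypotheses = the statements of
`stub_finder` (conclusion), `stub_dualValue`, `stub_certify`). The SAFE PARTIAL DECIDER of the MM side, in the
coin model of `PromiseBPP'`: an `FP` function `dec` on `⟨x, coins⟩` answering `[true]` (accept) / `[false]`
(reject) / anything else (pass) such that on EVERY promise instance of `signedCubicForrelationProblem 2` the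
wrong answer has probability `≤ 1/10`, and on promise instances one of whose two functions has a
half-dimensional M-subspace the right answer has probability `≥ 9/10`. Machine: parse (`ForrCode`); for the
second and then the first circuit (swap the two circuit codes — `Φ` is symmetric) run `find` on three fresh coin
blocks and CERTIFY each output (`F2Elim` rank `= n/2`, i.e. `|V|² = 2ⁿ`; second differences of row pairs at `0`
and unit vectors — sound by `stub_certify`, complete trivially); nothing certified ⇒ pass; else with the
certified rows for (say) `g`: 200 rounds of — `z` uniform (coins), linear part of `g` on `z ⊕ V` from the rows,
one linear solve for `x₀`, `x = x₀ ⊕ u` with `u` a uniform combination of a kernel basis (`F2Elim.kvec`) of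
`V^⊥`, record `(-1)^{f x + g z + x·z}` — accept iff the sum is positive. By `stub_dualValue` the rounds are
i.i.d. `±1` with mean EXACTLY `Φ`, so Chebyshev gives a wrong sign with probability `≤ 1/72` at `|Φ| ≥ 3/5`
(SAFE); on the MM side the finder certifies with probability `≥ 26/27` (COMPLETE): `1/27 + 1/72 < 1/10`.
Pattern: `CubicForrelationEstimatorMachine/Analysis.lean`, `PromiseBPPFromFPDecider.lean`. -/
theorem stub_safeMM :
    (∃ find ∈ FP, ∃ p : Polynomial ℕ, ∀ (I : KForrelationInstance) (hk : I.k = 2),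
      Even I.n → I.IsOverB2 → (∀ i, IsDegLeFun 3 (I.C i).eval) → (3 / 5 : ℝ) ≤ |I.value| →
      (∃ V : Finset (Fin I.n → Bool), zeroVec ∈ V ∧ (∀ x ∈ V, ∀ y ∈ V, bxor x y ∈ V) ∧
        (V.card : ℝ) ^ 2 = (2 : ℝ) ^ I.n ∧
        ∀ u ∈ V, ∀ v ∈ V, ∀ y, ((I.C (Fin.cast hk.symm 1)).eval y ^^
          (I.C (Fin.cast hk.symm 1)).eval (bxor y u) ^^ (I.C (Fin.cast hk.symm 1)).eval (bxor y v) ^^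
          (I.C (Fin.cast hk.symm 1)).eval (bxor y (bxor u v))) = false) →
      (2 / 3 : ℝ) ≤ uniformProb (p.eval I.encode.length)
        {y | ∃ L : List (List Bool), find (boolPair I.encode y) = encList L ∧
          2 * Module.finrank (ZMod 2) ↥(F2Elim.rowSpan I.n L) = I.n ∧
          ∀ u v : Fin I.n → Bool, (fun i => if u i then (1 : ZMod 2) else 0) ∈ F2Elim.rowSpan I.n L →
            (fun i => if v i then (1 : ZMod 2) else 0) ∈ F2Elim.rowSpan I.n L →
          ∀ y, ((I.C (Fin.cast hk.symm 1)).eval y ^^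
            (I.C (Fin.cast hk.symm 1)).eval (bxor y u) ^^ (I.C (Fin.cast hk.symm 1)).eval (bxor y v) ^^
            (I.C (Fin.cast hk.symm 1)).eval (bxor y (bxor u v))) = false}) →
    (∀ (n : ℕ) (f g : (Fin n → Bool) → Bool) (V : Finset (Fin n → Bool)),
      zeroVec ∈ V → (∀ x ∈ V, ∀ y ∈ V, bxor x y ∈ V) →
      (∀ u ∈ V, ∀ v ∈ V, ∀ y, (g y ^^ g (bxor y u) ^^ g (bxor y v) ^^ g (bxor y (bxor u v))) = false) →
      (∑ z : Fin n → Bool,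
          ∑ x ∈ univ.filter (fun x => ∀ v ∈ V, twist x v = signOf (g (bxor z v)) * signOf (g z)),
            signOf (f x) * signOf (g z) * twist x z =
        Real.sqrt (2 ^ (3 * n)) * forrelation f g) ∧
      (∀ z : Fin n → Bool,
        ((univ.filter (fun x => ∀ v ∈ V, twist x v = signOf (g (bxor z v)) * signOf (g z))).card : ℝ) *
          V.card = (2 : ℝ) ^ n)) →
    (∀ (n : ℕ) (g : (Fin n → Bool) → Bool), IsDegLeFun 3 g →
      ∀ L : List (List Bool),
      (∀ r ∈ L, ∀ s ∈ L, ∀ y : Fin n → Bool, (y = zeroVec ∨ ∃ i : Fin n, y = fun j => decide (j = i)) →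
        (g y ^^ g (bxor y (fun i => r.getD i false)) ^^ g (bxor y (fun i => s.getD i false)) ^^
          g (bxor y (bxor (fun i => r.getD i false) (fun i => s.getD i false)))) = false) →
      ∀ u v : Fin n → Bool, (fun i => if u i then (1 : ZMod 2) else 0) ∈ F2Elim.rowSpan n L →
        (fun i => if v i then (1 : ZMod 2) else 0) ∈ F2Elim.rowSpan n L →
      ∀ y, (g y ^^ g (bxor y u) ^^ g (bxor y v) ^^ g (bxor y (bxor u v))) = false) →
    ∃ dec ∈ FP, ∃ p : Polynomial ℕ,
      (∀ x ∈ (signedCubicForrelationProblem 2).yes,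
        uniformProb (p.eval x.length) {y | dec (boolPair x y) = [false]} ≤ 1 / 10) ∧
      (∀ x ∈ (signedCubicForrelationProblem 2).no,
        uniformProb (p.eval x.length) {y | dec (boolPair x y) = [true]} ≤ 1 / 10) ∧
      (∀ x ∈ KForrelationInstance.encode ''
          {I | I.IsYes ∧ (∃ i, ∃ V : Finset (Fin I.n → Bool), zeroVec ∈ V ∧
            (∀ x ∈ V, ∀ y ∈ V, bxor x y ∈ V) ∧ (V.card : ℝ) ^ 2 = (2 : ℝ) ^ I.n ∧
            ∀ u ∈ V, ∀ v ∈ V, ∀ y, ((I.C i).eval y ^^ (I.C i).eval (bxor y u) ^^ (I.C i).eval (bxor y v) ^^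
              (I.C i).eval (bxor y (bxor u v))) = false) ∧
            I.k = 2 ∧ Even I.n ∧ ∀ i, IsDegLeFun 3 (I.C i).eval},
        (9 / 10 : ℝ) ≤ uniformProb (p.eval x.length) {y | dec (boolPair x y) = [true]}) ∧
      (∀ x ∈ KForrelationInstance.encode ''
          {I | (I.IsOverB2 ∧ I.value ≤ -(3 / 5 : ℝ)) ∧ (∃ i, ∃ V : Finset (Fin I.n → Bool), zeroVec ∈ V ∧
            (∀ x ∈ V, ∀ y ∈ V, bxor x y ∈ V) ∧ (V.card : ℝ) ^ 2 = (2 : ℝ) ^ I.n ∧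
            ∀ u ∈ V, ∀ v ∈ V, ∀ y, ((I.C i).eval y ^^ (I.C i).eval (bxor y u) ^^ (I.C i).eval (bxor y v) ^^
              (I.C i).eval (bxor y (bxor u v))) = false) ∧
            I.k = 2 ∧ Even I.n ∧ ∀ i, IsDegLeFun 3 (I.C i).eval},
        (9 / 10 : ℝ) ≤ uniformProb (p.eval x.length) {y | dec (boolPair x y) = [false]}) := by
  sorry

/-- STUB `stub_safeMMR` (XL formalisation; closed given its hypotheses — the r1 machine `stub_safeMM` with the number of rounds
read off the certificate: `N := 200 · 4^t`, `t := ⌈(n − 2·rank L)/2⌉ ≤ c'·log₂(n+2)/2`, so `N ≤ 200·(n+2)^{c'}`). The SAFE PARTIAL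
DECIDER of the RELAXED MM side: wrong with probability `≤ 1/10` on every promise instance of `signedCubicForrelationProblem 2`;
answering correctly with probability `≥ 9/10` on promise instances one of whose functions has M-defect `≤ c·log₂(n+2)`. The statistic
`(-1)^{f x + g z + x·z}` over uniformly sampled matched pairs has mean EXACTLY `Φ·|V|/2^{n/2} ≥ (3/5)·2^{-t}` (dual-value identity for ANY
certified `V`; Chebyshev with `N·(3/5)²·4^{-t} ≥ 72`). -/
theorem stub_safeMMR : ∀ c c' : ℕ,
    (∃ find ∈ FP, ∃ p : Polynomial ℕ, ∀ (I : KForrelationInstance) (hk : I.k = 2),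
      Even I.n → I.IsOverB2 → (∀ i, IsDegLeFun 3 (I.C i).eval) → (3 / 5 : ℝ) ≤ |I.value| →
      (∃ V : Finset (Fin I.n → Bool), zeroVec ∈ V ∧ (∀ x ∈ V, ∀ y ∈ V, bxor x y ∈ V) ∧
        2 ^ I.n ≤ V.card ^ 2 * (I.n + 2) ^ (2 * c) ∧
        ∀ u ∈ V, ∀ v ∈ V, ∀ y, ((I.C (Fin.cast hk.symm 1)).eval y ^^
          (I.C (Fin.cast hk.symm 1)).eval (bxor y u) ^^ (I.C (Fin.cast hk.symm 1)).eval (bxor y v) ^^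
          (I.C (Fin.cast hk.symm 1)).eval (bxor y (bxor u v))) = false) →
      (2 / 3 : ℝ) ≤ uniformProb (p.eval I.encode.length)
        {y | ∃ L : List (List Bool), find (boolPair I.encode y) = encList L ∧
          I.n ≤ 2 * Module.finrank (ZMod 2) ↥(F2Elim.rowSpan I.n L) + c' * Nat.log 2 (I.n + 2) ∧
          ∀ u v : Fin I.n → Bool, (fun i => if u i then (1 : ZMod 2) else 0) ∈ F2Elim.rowSpan I.n L →
            (fun i => if v i then (1 : ZMod 2) else 0) ∈ F2Elim.rowSpan I.n L →
          ∀ y, ((I.C (Fin.cast hk.symm 1)).eval y ^^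
            (I.C (Fin.cast hk.symm 1)).eval (bxor y u) ^^ (I.C (Fin.cast hk.symm 1)).eval (bxor y v) ^^
            (I.C (Fin.cast hk.symm 1)).eval (bxor y (bxor u v))) = false}) →
    (∀ (n : ℕ) (f g : (Fin n → Bool) → Bool) (V : Finset (Fin n → Bool)),
      zeroVec ∈ V → (∀ x ∈ V, ∀ y ∈ V, bxor x y ∈ V) →
      (∀ u ∈ V, ∀ v ∈ V, ∀ y, (g y ^^ g (bxor y u) ^^ g (bxor y v) ^^ g (bxor y (bxor u v))) = false) →
      (∑ z : Fin n → Bool,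
          ∑ x ∈ univ.filter (fun x => ∀ v ∈ V, twist x v = signOf (g (bxor z v)) * signOf (g z)),
            signOf (f x) * signOf (g z) * twist x z =
        Real.sqrt (2 ^ (3 * n)) * forrelation f g) ∧
      (∀ z : Fin n → Bool,
        ((univ.filter (fun x => ∀ v ∈ V, twist x v = signOf (g (bxor z v)) * signOf (g z))).card : ℝ) *
          V.card = (2 : ℝ) ^ n)) →
    (∀ (n : ℕ) (g : (Fin n → Bool) → Bool), IsDegLeFun 3 g →
      ∀ L : List (List Bool),
      (∀ r ∈ L, ∀ s ∈ L, ∀ y : Fin n → Bool, (y = zeroVec ∨ ∃ i : Fin n, y = fun j => decide (j = i)) →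
        (g y ^^ g (bxor y (fun i => r.getD i false)) ^^ g (bxor y (fun i => s.getD i false)) ^^
          g (bxor y (bxor (fun i => r.getD i false) (fun i => s.getD i false)))) = false) →
      ∀ u v : Fin n → Bool, (fun i => if u i then (1 : ZMod 2) else 0) ∈ F2Elim.rowSpan n L →
        (fun i => if v i then (1 : ZMod 2) else 0) ∈ F2Elim.rowSpan n L →
      ∀ y, (g y ^^ g (bxor y u) ^^ g (bxor y v) ^^ g (bxor y (bxor u v))) = false) →
    ∃ dec ∈ FP, ∃ p : Polynomial ℕ,
      (∀ x ∈ (signedCubicForrelationProblem 2).yes,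
        uniformProb (p.eval x.length) {y | dec (boolPair x y) = [false]} ≤ 1 / 10) ∧
      (∀ x ∈ (signedCubicForrelationProblem 2).no,
        uniformProb (p.eval x.length) {y | dec (boolPair x y) = [true]} ≤ 1 / 10) ∧
      (∀ x ∈ KForrelationInstance.encode ''
          {I | I.IsYes ∧ (∃ i, ∃ V : Finset (Fin I.n → Bool), zeroVec ∈ V ∧
            (∀ x ∈ V, ∀ y ∈ V, bxor x y ∈ V) ∧ 2 ^ I.n ≤ V.card ^ 2 * (I.n + 2) ^ (2 * c) ∧
            ∀ u ∈ V, ∀ v ∈ V, ∀ y, ((I.C i).eval y ^^ (I.C i).eval (bxor y u) ^^ (I.C i).eval (bxor y v) ^^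
              (I.C i).eval (bxor y (bxor u v))) = false) ∧
            I.k = 2 ∧ Even I.n ∧ ∀ i, IsDegLeFun 3 (I.C i).eval},
        (9 / 10 : ℝ) ≤ uniformProb (p.eval x.length) {y | dec (boolPair x y) = [true]}) ∧
      (∀ x ∈ KForrelationInstance.encode ''
          {I | (I.IsOverB2 ∧ I.value ≤ -(3 / 5 : ℝ)) ∧ (∃ i, ∃ V : Finset (Fin I.n → Bool), zeroVec ∈ V ∧
            (∀ x ∈ V, ∀ y ∈ V, bxor x y ∈ V) ∧ 2 ^ I.n ≤ V.card ^ 2 * (I.n + 2) ^ (2 * c) ∧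
            ∀ u ∈ V, ∀ v ∈ V, ∀ y, ((I.C i).eval y ^^ (I.C i).eval (bxor y u) ^^ (I.C i).eval (bxor y v) ^^
              (I.C i).eval (bxor y (bxor u v))) = false) ∧
            I.k = 2 ∧ Even I.n ∧ ∀ i, IsDegLeFun 3 (I.C i).eval},
        (9 / 10 : ℝ) ≤ uniformProb (p.eval x.length) {y | dec (boolPair x y) = [false]}) := by
  sorry

/-- STUB `stub_residueR` (OPEN, crux-sized, NEVER FALSER THAN THE CRUX — `residueR_of_crux`). For some defect constant `c`,
the signed problem restricted to promise instances NEITHER of whose functions is affine on the cosets of a `⊕`-closed `V ∋ 0`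
with `2ⁿ ≤ |V|²(n+2)^{2c}` (both-sided M-defect `> c·log₂(n+2)`) is in `PromiseBPP'`. Contains NO instance on file (P₄ has
defect 2; MM-shaped families defect 0); the intended discharge is `stub_structure` (then the residue is EMPTY:
`residueR_of_structure`), the alternative is the block/flag programme of the sibling cards. -/
theorem stub_residueR : ∃ c : ℕ,
    (⟨KForrelationInstance.encode ''
        {I | I.IsYes ∧ ¬ (∃ i, ∃ V : Finset (Fin I.n → Bool), zeroVec ∈ V ∧
            (∀ x ∈ V, ∀ y ∈ V, bxor x y ∈ V) ∧ 2 ^ I.n ≤ V.card ^ 2 * (I.n + 2) ^ (2 * c) ∧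
            ∀ u ∈ V, ∀ v ∈ V, ∀ y, ((I.C i).eval y ^^ (I.C i).eval (bxor y u) ^^ (I.C i).eval (bxor y v) ^^
              (I.C i).eval (bxor y (bxor u v))) = false) ∧
          I.k = 2 ∧ Even I.n ∧ ∀ i, IsDegLeFun 3 (I.C i).eval},
      KForrelationInstance.encode ''
        {I | (I.IsOverB2 ∧ I.value ≤ -(3 / 5 : ℝ)) ∧ ¬ (∃ i, ∃ V : Finset (Fin I.n → Bool), zeroVec ∈ V ∧
            (∀ x ∈ V, ∀ y ∈ V, bxor x y ∈ V) ∧ 2 ^ I.n ≤ V.card ^ 2 * (I.n + 2) ^ (2 * c) ∧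
            ∀ u ∈ V, ∀ v ∈ V, ∀ y, ((I.C i).eval y ^^ (I.C i).eval (bxor y u) ^^ (I.C i).eval (bxor y v) ^^
              (I.C i).eval (bxor y (bxor u v))) = false) ∧
          I.k = 2 ∧ Even I.n ∧ ∀ i, IsDegLeFun 3 (I.C i).eval}⟩ : PromiseProblem) ∈ PromiseBPP' := by
  sorry

/-- STUB `stub_passThrough` (L, generic plumbing, provable now). PASS-THROUGH COMPOSITION for textbook
promise-BPP: a safe partial decider for `Q` on `(EY, EN)` (wrong with probability `≤ 1/10` on the whole promise
of `Q`; answering correctly with probability `≥ 9/10` on `EY`/`EN`) together with ANY `PromiseBPP'` decider of a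
promise problem `R` covering the rest (`Q.yes ∖ EY ⊆ R.yes`, `Q.no ∖ EN ⊆ R.no`) puts `Q` in `PromiseBPP'`:
amplify `R` to error `1/10` (`PromiseProblem.exists_amplifier_of_mem_PromiseBPP'` with `r = 9`), run `dec` on
the first coin block and, unless it answers, the amplified decider on the second (`truncSndFn` / `dropSndFn`,
`cnt_take_drop`); union bound `1/10 + 1/10 < 1/3` in all four cases. -/
theorem stub_passThrough : ∀ (Q R : PromiseProblem) (EY EN : Set (List Bool)),
    (∃ dec ∈ FP, ∃ p : Polynomial ℕ,
      (∀ x ∈ Q.yes, uniformProb (p.eval x.length) {y | dec (boolPair x y) = [false]} ≤ 1 / 10) ∧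
      (∀ x ∈ Q.no, uniformProb (p.eval x.length) {y | dec (boolPair x y) = [true]} ≤ 1 / 10) ∧
      (∀ x ∈ EY, (9 / 10 : ℝ) ≤ uniformProb (p.eval x.length) {y | dec (boolPair x y) = [true]}) ∧
      (∀ x ∈ EN, (9 / 10 : ℝ) ≤ uniformProb (p.eval x.length) {y | dec (boolPair x y) = [false]})) →
    R ∈ PromiseBPP' →
    (∀ x ∈ Q.yes, x ∉ EY → x ∈ R.yes) → (∀ x ∈ Q.no, x ∉ EN → x ∈ R.no) → Q ∈ PromiseBPP' := by
  -- LANDED (p86886, `Theorems.SignedCubicForrelationInPrBPP.stub_passThrough`); temporarily `sorry` here only because the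
  -- hub has not built that module yet (farm `unbuilt` backlog) — replace by the theorem once it is importable.
  sorry

/-! ## Small sorry-free glue -/

/-- The empty promise problem is (vacuously) in `PromiseBPP'`. -/
theorem empty_mem_PromiseBPP' : (⟨⊥, ⊥⟩ : PromiseProblem) ∈ PromiseBPP' :=
  ⟨⊥, bot_mem_P, 0, fun x hx => (Set.notMem_empty x hx).elim, fun x hx => (Set.notMem_empty x hx).elim⟩

/-- On a promise instance the structure conjecture puts one of the two circuits on the relaxed MM side. -/
theorem relaxedMM_of_structure {c : ℕ}
    (hc : ∀ (n : ℕ), Even n → ∀ f g : (Fin n → Bool) → Bool,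
      IsDegLeFun 3 f → IsDegLeFun 3 g → (3 / 5 : ℝ) ≤ |forrelation f g| →
      ∃ V : Finset (Fin n → Bool), zeroVec ∈ V ∧ (∀ x ∈ V, ∀ y ∈ V, bxor x y ∈ V) ∧
        2 ^ n ≤ V.card ^ 2 * (n + 2) ^ (2 * c) ∧
        ((∀ u ∈ V, ∀ v ∈ V, ∀ y, (f y ^^ f (bxor y u) ^^ f (bxor y v) ^^ f (bxor y (bxor u v))) = false) ∨
         (∀ u ∈ V, ∀ v ∈ V, ∀ y, (g y ^^ g (bxor y u) ^^ g (bxor y v) ^^ g (bxor y (bxor u v))) = false)))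
    (I : KForrelationInstance) (hk : I.k = 2) (hn : Even I.n) (hdeg : ∀ i, IsDegLeFun 3 (I.C i).eval)
    (hΦ : (3 / 5 : ℝ) ≤ |I.value|) :
    ∃ i, ∃ V : Finset (Fin I.n → Bool), zeroVec ∈ V ∧
      (∀ x ∈ V, ∀ y ∈ V, bxor x y ∈ V) ∧ 2 ^ I.n ≤ V.card ^ 2 * (I.n + 2) ^ (2 * c) ∧
      ∀ u ∈ V, ∀ v ∈ V, ∀ y, ((I.C i).eval y ^^ (I.C i).eval (bxor y u) ^^ (I.C i).eval (bxor y v) ^^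
        (I.C i).eval (bxor y (bxor u v))) = false := by
  rw [KForrelationInstance.value_eq_forrelation hk] at hΦ
  obtain ⟨V, h0, hadd, hcard, hf | hg⟩ := hc I.n hn _ _ (hdeg _) (hdeg _) hΦ
  · exact ⟨_, V, h0, hadd, hcard, hf⟩
  · exact ⟨_, V, h0, hadd, hcard, hg⟩

/-! ## Composition: the stubs prove the crux BY NAME -/

/-- Vocabulary for the bookkeeping: the relaxed MM side at defect constant `c` (one circuit affine on the cosets of a large
`⊕`-closed `V ∋ 0`). -/
def HasLogMSubspace (c : ℕ) (I : KForrelationInstance) : Prop :=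
  ∃ i, ∃ V : Finset (Fin I.n → Bool), zeroVec ∈ V ∧
    (∀ x ∈ V, ∀ y ∈ V, bxor x y ∈ V) ∧ 2 ^ I.n ≤ V.card ^ 2 * (I.n + 2) ^ (2 * c) ∧
    ∀ u ∈ V, ∀ v ∈ V, ∀ y, ((I.C i).eval y ^^ (I.C i).eval (bxor y u) ^^ (I.C i).eval (bxor y v) ^^
      (I.C i).eval (bxor y (bxor u v))) = false

/-- Side conditions of the crux's promise: two circuits, `n` even, both of 𝔽₂-degree `≤ 3`. -/
def SideConds (I : KForrelationInstance) : Prop :=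
  I.k = 2 ∧ Even I.n ∧ ∀ i, IsDegLeFun 3 (I.C i).eval

/-- **The line closes the crux (r2).** The relaxed finder (for the residue's defect constant `c`) feeds the safe partial
decider, which handles every promise instance on the relaxed MM side; the rest is `stub_residueR`; pass-through glues. -/
theorem SignedCubicForrelationInPrBPP_of : SignedCubicForrelationInPrBPP := by
  show signedCubicForrelationProblem 2 ∈ PromiseBPP'
  obtain ⟨c, hR⟩ := stub_residueR
  obtain ⟨c', hF⟩ := stub_finderR c
  have hS := stub_safeMMR c c' hF stub_dualValue stub_certify
  refine stub_passThrough (signedCubicForrelationProblem 2) _ _ _ hS hR ?_ ?_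
  · rintro _ ⟨I, hI, rfl⟩ hx
    exact ⟨I, ⟨hI.1, fun hM => hx ⟨I, ⟨hI.1, hM, hI.2⟩, rfl⟩, hI.2⟩, rfl⟩
  · rintro _ ⟨I, hI, rfl⟩ hx
    exact ⟨I, ⟨hI.1, fun hM => hx ⟨I, ⟨hI.1, hM, hI.2⟩, rfl⟩, hI.2⟩, rfl⟩

/-! ## The two ways to discharge the residue, and its safety (sorry-free) -/

/-- `stub_structure` EMPTIES the residue: with its constant `c` no promise instance has both-sided defect `> c log`. -/
theorem residueR_of_structure
    (h : ∃ c : ℕ, ∀ (n : ℕ), Even n → ∀ f g : (Fin n → Bool) → Bool,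
      IsDegLeFun 3 f → IsDegLeFun 3 g → (3 / 5 : ℝ) ≤ |forrelation f g| →
      ∃ V : Finset (Fin n → Bool), zeroVec ∈ V ∧ (∀ x ∈ V, ∀ y ∈ V, bxor x y ∈ V) ∧
        2 ^ n ≤ V.card ^ 2 * (n + 2) ^ (2 * c) ∧
        ((∀ u ∈ V, ∀ v ∈ V, ∀ y, (f y ^^ f (bxor y u) ^^ f (bxor y v) ^^ f (bxor y (bxor u v))) = false) ∨
         (∀ u ∈ V, ∀ v ∈ V, ∀ y, (g y ^^ g (bxor y u) ^^ g (bxor y v) ^^ g (bxor y (bxor u v))) = false))) :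
    ∃ c : ℕ, (⟨KForrelationInstance.encode '' {I | I.IsYes ∧ ¬ HasLogMSubspace c I ∧ SideConds I},
      KForrelationInstance.encode ''
        {I | (I.IsOverB2 ∧ I.value ≤ -(3 / 5 : ℝ)) ∧ ¬ HasLogMSubspace c I ∧ SideConds I}⟩ : PromiseProblem) ∈
      PromiseBPP' := by
  obtain ⟨c, hc⟩ := h
  refine ⟨c, ⊥, bot_mem_P, 0, ?_, ?_⟩
  · rintro _ ⟨I, hI, rfl⟩
    exact (hI.2.1 (relaxedMM_of_structure hc I hI.2.2.1 hI.2.2.2.1 hI.2.2.2.2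
      (le_trans hI.1.2 (le_abs_self _)))).elim
  · rintro _ ⟨I, hI, rfl⟩
    refine (hI.2.1 (relaxedMM_of_structure hc I hI.2.2.1 hI.2.2.2.1 hI.2.2.2.2 ?_)).elim
    have h := hI.1.2
    rw [abs_eq_neg_self.mpr (by linarith)]
    linarith

/-- The residue is a SUB-promise of the crux for every `c` (so `stub_residueR` is implied by the crux, never falser). -/
theorem residueR_of_crux (h : SignedCubicForrelationInPrBPP) (c : ℕ) :
    (⟨KForrelationInstance.encode '' {I | I.IsYes ∧ ¬ HasLogMSubspace c I ∧ SideConds I},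
      KForrelationInstance.encode ''
        {I | (I.IsOverB2 ∧ I.value ≤ -(3 / 5 : ℝ)) ∧ ¬ HasLogMSubspace c I ∧ SideConds I}⟩ : PromiseProblem) ∈
      PromiseBPP' := by
  obtain ⟨L', hL', p, hyes, hno⟩ := h
  refine ⟨L', hL', p, fun x hx => hyes x ?_, fun x hx => hno x ?_⟩
  · obtain ⟨I, hI, rfl⟩ := hx
    exact ⟨I, ⟨hI.1, hI.2.2⟩, rfl⟩
  · obtain ⟨I, hI, rfl⟩ := hx
    exact ⟨I, ⟨hI.1, hI.2.2⟩, rfl⟩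

/-- Wiring check: `stub_structure` does discharge `stub_residueR` (the statement shapes agree). -/
example : ∃ c : ℕ, (⟨KForrelationInstance.encode '' {I | I.IsYes ∧ ¬ HasLogMSubspace c I ∧ SideConds I},
      KForrelationInstance.encode ''
        {I | (I.IsOverB2 ∧ I.value ≤ -(3 / 5 : ℝ)) ∧ ¬ HasLogMSubspace c I ∧ SideConds I}⟩ : PromiseProblem) ∈
      PromiseBPP' :=
  residueR_of_structure stub_structure

/-! ## Sanity checks (sorry-free) -/

/-- The crux, by name, is membership of the tree's `signedCubicForrelationProblem 2` (Disproof.lean `crux_eq`). -/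
example : SignedCubicForrelationInPrBPP = (signedCubicForrelationProblem 2 ∈ PromiseBPP') := rfl

end Summit.QuantumAdvantage.QuantumAdvantage.Cruxes.SignedCubicForrelationInPrBPP.PolarRadicalSeeds

end
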